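import Literature.AlgebraicGeometry.AbelianSchemes.AbelianSchemeQuotientMulNDescent
import Literature.AlgebraicGeometry.AbelianSchemes.RigidifiedLineBundleComapHom
import Literature.AlgebraicGeometry.AbelianSchemes.AbelianSchemeDualTransport
import HarnessLib

/-!
# `𝒩₁ = (π × 1)^*𝒫` on `(A/K) ×_S Â` and its stabiliser — carriers of the two-step descent (HECKE-LINK H2, file (ii) part 1)

Layer `Literature/AlgebraicGeometry/AbelianSchemes`, namespace `Literature.AlgebraicGeometry.AbelianSchemes.AbelianSchemeOver`.
Cell `hodgecm-mathlib`, HECKE-LINK line card v1.2 §1 (file (ii) = critical path), census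
`B-provers/B-p20/g9/CENSUS-H2-DualPairOfQuotient.B-p20g9.md` §1, over ★ file (i) `AbelianSchemeConstSubgroupQuotient` (p742166:
`ψ = quotientMk`, `A/K = quotientBy`), ★ D0 `AbelianSchemeQuotientMulNDescent` (p742656: `π = mulNDesc`, `ψ ≫ π = [n]`,
`π` a homomorphism), ★ (u1) `RigidifiedLineBundleComapHom` (p743509) and ★ `AbelianSchemeDualTransport` (`selfBundle`).
[MumfordAV1970] §15 Thm. 1 (p. 143) («the dual of `A/C` is `Â/C^⊥`»), §7 Thm. 4, §23; [MilneAV2008] I §8–§9.  TWO-STEP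
DESIGN of the dual pair of `B := A/K` from a dual pair `(Â, 𝒫)` of `A` (`K ⊆ A[n](S)` finite constant, free): the
`K`-half of the descent of `𝒫^{⊗n}`-type data is the LITERAL pull-back `𝒩₁ := (π × 1)^*𝒫` along the descended isogeny
`π : B → A`; the `Â`-half descends `𝒩₁` along `B × Â → B × (Â/K′)` for a finite `K′` inside the STABILISER of `𝒩₁` under
the translations of `Â` (★ T1 `ActionOver.exists_descent_of_free` over the action `prodTranslationActionOver`, D3a).
CONTENTS (constructions with bodies + theorems; 0 `Prop`-valued def, no instance, no sorry):
* §1 (D1) `mulNDescProdSection k := lift π (! ≫ k) : B → A ⊗ Â` and the dual-kernel SET `dualKernelSet D ⊆ Â(S)`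
  (`(π × k)^*𝒫 ≅ 𝒪`; counting input of the universality proof only);
* §3 in the WHISKERING currency of `Over S` (`(X ⊗ Y).left = X ×_S Y` by `rfl`): **`poincarePullbackBundle := (selfBundle D).comapHom π`**,
  `𝒩₁` as a RIGIDIFIED fibrewise-`Pic⁰` family on `B` parametrised by `Â` (rank one, rigidification along `e_B × 1`, and
  `poincarePullbackBundle_fibrewisePicZero` for free), its module `poincarePullback`, the translations `B ◁ t_k`
  (`whiskerLeft_translation_mul/_one`), the STABILISER `poincareStabilizer D ⊆ Â(S)` of `𝒩₁` under the `(B ◁ t_k).left`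
  and the SUBGROUP `poincareStabilizerSubgroup` (`K′_max`; formal: `one/mul/inv_mem_poincareStabilizer`).
Follow-ups (other files): D3a the `K′`-action (B-p06 (g9) `AbelianSchemeQuotientDualSideAction`), D3b the normalised
`K′`-equivariant structure on `𝒩₁` (B-p19 (g12) `AbelianSchemeQuotientPoincareEquivariant`), D4 the descended sheaf and the
assembly `AbelianSchemeQuotientDualPair`, D5/D6 the dual-pair axioms.  HC_CM is proved only modulo the 7 printed
citations until rung 0 closes; nothing here is about HC.

## References
* [MumfordAV1970] D. Mumford, *Abelian Varieties* (1970), §7 Thm. 4 (p. 72), §12 Thm. 1, §15 Thm. 1 (p. 143).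
* [MilneAV2008] J. S. Milne, *Abelian Varieties* (2008), I §8–§9.
-/

noncomputable section

universe u

open CategoryTheory CategoryTheory.Limits AlgebraicGeometry MonoidalCategory CartesianMonoidalCategory
open scoped MonObj

namespace Literature.AlgebraicGeometry.AbelianSchemes

namespace AbelianSchemeOver

open Literature.AlgebraicGeometry.RelativeSpec Literature.AlgebraicGeometry.AbelianVarieties
  Literature.AlgebraicGeometry.Motives

variable {S : Scheme.{u}} (A : AbelianSchemeOver S)
  {Y : Scheme.{u}} (u : S ⟶ Y) (K : Subgroup A.Sections) [IsCommMonObj A.X] {n : ℕ}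
  (hK : ∀ σ : K, (σ : A.Sections) ^ n = 1)
  [Finite K] [Y.IsSeparated] [IsSeparated (A.X.hom ≫ u)] [S.IsSeparated]
  (hcov : ∀ x : A.left, ∃ O : (A.translationActionOver u K).StableAffineOpens, x ∈ O.1)
  [LocallyOfFiniteType (A.X.hom ≫ u)] [IsLocallyNoetherian Y]
  (hG : ∃ _ : GrpObj (A.quotientOver u K), IsMonHom (A.quotientMk u K hcov))
  (hsm : Smooth (A.quotientOver u K).hom) (hgc : GeometricallyConnected (A.quotientOver u K).hom)
  (D : A.DualPair)

/-! ## §1 (D1) The dual kernel of `π` as a set of sections of `Â` -/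

/-- **`(π × k) : B → A ×_S Â`** for a section `k` of `Â` (`B := A/K`, `π = mulNDesc`), as the `Over S`-morphism
`lift π (! ≫ k) : B → A ⊗ Â`: the slice along which `𝒫` is read to decide whether `k` lies in the dual kernel of `π`.
[cite: MumfordAV1970, §15 Thm. 1 (p. 143)] -/
def mulNDescProdSection (k : D.hat.Sections) : (A.quotientBy u K hcov hG hsm hgc).X ⟶ A.X ⊗ D.hat.X :=
  CartesianMonoidalCategory.lift (A.mulNDesc u K hK hcov) (toUnit _ ≫ k)

/-- **The DUAL KERNEL of `π : A/K → A`** as a set of sections of `Â`: `k ∈ ker π^*` iff `(π × k)^*𝒫 ≅ 𝒪` (the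
rigidified family `(1 × k)^*𝒫` becomes trivial after pull-back along `π`).  Used only for the COUNTING input of D6
(`#K′`); the descent itself runs on the stabiliser (§3).  NO Weil pairing of sections. [cite: MumfordAV1970, §15 Thm. 1 (p. 143)] -/
def dualKernelSet : Set D.hat.Sections :=
  {k | Nonempty ((Scheme.Modules.pullback (A.mulNDescProdSection u K hK hcov hG hsm hgc D k).left).obj D.P ≅
    SheafOfModules.unit _)}

/-- Membership in the dual kernel, unfolded. [cite: MumfordAV1970, §15 Thm. 1 (p. 143)] -/
theorem mem_dualKernelSet_iff (k : D.hat.Sections) :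
    k ∈ A.dualKernelSet u K hK hcov hG hsm hgc D ↔
      Nonempty ((Scheme.Modules.pullback (A.mulNDescProdSection u K hK hcov hG hsm hgc D k).left).obj D.P ≅
        SheafOfModules.unit _) :=
  Iff.rfl

/-! ## §3 (D3/D4 carriers, in the WHISKERING currency of `Over S` — `(X ⊗ Y).left = X.prodLeft Y` by `rfl`)
`(π ▷ Â)`, `𝒩₁ = (π ▷ Â)^*𝒫`, `(B ◁ t_k)`, the stabiliser `K′_max`, `(B ◁ ψ̂)` -/

variable [IsAffine Y]
  (hfree : ∀ (Ω : Type u) [Field Ω] [IsAlgClosed Ω] (x : Spec (.of Ω) ⟶ A.left) (σ : K), σ ≠ 1 →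
    x ≫ (A.translation (σ : A.Sections)).left ≠ x)

/-- **`𝒩₁ := (π × 1)^*𝒫` AS A RIGIDIFIED FAMILY on `B := A/K` parametrised by `Â`**: the pull-back of `𝒫` (as the
rigidified family ★ `DualPair.selfBundle D` on `A_{Â}`) along the HOMOMORPHISM `π = mulNDesc` (★ (u1)
`RigidifiedLineBundle.comapHom`, p743509) — so `𝒩₁` comes with rank one, its rigidification along `e_B × 1`
(`π ∘ e_B = e_A`) and (below) the fibrewise-`Pic⁰` property FOR FREE.  The `K`-half of the two-step descent is this
literal pull-back. [cite: MumfordAV1970, §15 Thm. 1 (p. 143)] -/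
def poincarePullbackBundle : (A.quotientBy u K hcov hG hsm hgc).RigidifiedLineBundle D.hat.X.hom :=
  @RigidifiedLineBundle.comapHom S (A.quotientBy u K hcov hG hsm hgc) A D.hat.X.left (A.mulNDesc u K hK hcov)
    (A.isMonHom_mulNDesc u K hK hcov hG hsm hgc hfree) D.hat.X.hom (DualPair.selfBundle D)

/-- `𝒩₁` lies fibrewise in `Pic⁰` (★ `FibrewisePicZero.comapHom` + ★ `selfBundle_fibrewisePicZero`).
[cite: MumfordAV1970, §15 Thm. 1 (p. 143)] -/
theorem poincarePullbackBundle_fibrewisePicZero :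
    (A.poincarePullbackBundle u K hK hcov hG hsm hgc D hfree).FibrewisePicZero := by
  exact @RigidifiedLineBundle.FibrewisePicZero.comapHom S (A.quotientBy u K hcov hG hsm hgc) A D.hat.X.left
    (A.mulNDesc u K hK hcov) (A.isMonHom_mulNDesc u K hK hcov hG hsm hgc hfree) D.hat.X.hom (DualPair.selfBundle D)
    (DualPair.selfBundle_fibrewisePicZero D)

/-- **The module `𝒩₁`** on `((A/K).X ⊗ D.hat.X).left = (A/K) ×_S Â` (= `((A/K).baseChange (Â → S)).left` by `rfl`).
[cite: MumfordAV1970, §15 Thm. 1 (p. 143)] -/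
def poincarePullback : (((A.quotientBy u K hcov hG hsm hgc).X ⊗ D.hat.X).left).Modules :=
  (A.poincarePullbackBundle u K hK hcov hG hsm hgc D hfree).L

/-- `𝒩₁ = (π_{Â})^*𝒫` (definitional). [cite: MumfordAV1970, §15 Thm. 1 (p. 143)] -/
theorem poincarePullback_eq :
    A.poincarePullback u K hK hcov hG hsm hgc D hfree =
      (Scheme.Modules.pullback (@baseChangeHom S (A.quotientBy u K hcov hG hsm hgc) A D.hat.X.left
        (A.mulNDesc u K hK hcov) D.hat.X.hom).left).obj D.P :=
  rfl

omit [IsCommMonObj A.X] [LocallyOfFiniteType (A.X.hom ≫ u)] [IsLocallyNoetherian Y] [S.IsSeparated] in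
/-- `B ◁ t_{kk′} = (B ◁ t_{k′}) ≫ (B ◁ t_k)` (★ `translation_comp` + `whiskerLeft_comp`).
[cite: MumfordAV1970, §15 Thm. 1 (p. 143)] -/
theorem whiskerLeft_translation_mul (B : Over S) (k k' : D.hat.Sections) :
    B ◁ D.hat.translation (k * k') = (B ◁ D.hat.translation k') ≫ (B ◁ D.hat.translation k) := by
  rw [← MonoidalCategory.whiskerLeft_comp, translation_comp]

omit [IsCommMonObj A.X] [LocallyOfFiniteType (A.X.hom ≫ u)] [IsLocallyNoetherian Y] [S.IsSeparated] in
/-- `B ◁ t_1 = 𝟙`. [cite: MumfordAV1970, §15 Thm. 1 (p. 143)] -/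
theorem whiskerLeft_translation_one (B : Over S) : B ◁ D.hat.translation 1 = 𝟙 _ := by
  have h : D.hat.translation 1 = 𝟙 _ := by rw [← translationAut_hom, map_one]; rfl
  rw [h, MonoidalCategory.whiskerLeft_id]

/-- **The STABILISER `K′_max` of `𝒩₁ = (π ▷ Â)^*𝒫` under the translations `B ◁ t_k`, `k ∈ Â(S)`** — the set of `k`
with `(B ◁ t_k)^*𝒩₁ ≅ 𝒩₁`.  THIS is what the two-step descent quotients by (D2: `B̂ := Â/K′`, `K′ ≤ K′_max` finite):
the isomorphisms of the `K′`-equivariant structure on `𝒩₁` (D3b, the `φ k` of ★ T1 `exists_descent_of_free` for the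
D3a action whose automorphisms are the `(B ◁ t_k).left`) then exist BY DEFINITION, the subgroup property is formal, and
only the cocycle normalisation needs geometry (rigidification along `e_B × 1` + ★ (P-St′) «rigidified automorphisms are
trivial over a reduced base»).  Its identification with `dualKernelSet` and its order on geometric fibres are inputs of
D6 only. [cite: MumfordAV1970, §15 Thm. 1 (p. 143)] [cite: MumfordAV1970, §23 (p. 231)] -/
def poincareStabilizer : Set D.hat.Sections :=
  {k | Nonempty ((Scheme.Modules.pullback ((A.quotientBy u K hcov hG hsm hgc).X ◁ D.hat.translation k).left).obj
    (A.poincarePullback u K hK hcov hG hsm hgc D hfree) ≅ A.poincarePullback u K hK hcov hG hsm hgc D hfree)}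

/-- Membership in the stabiliser, unfolded. [cite: MumfordAV1970, §15 Thm. 1 (p. 143)] -/
theorem mem_poincareStabilizer_iff (k : D.hat.Sections) :
    k ∈ A.poincareStabilizer u K hK hcov hG hsm hgc D hfree ↔
      Nonempty ((Scheme.Modules.pullback ((A.quotientBy u K hcov hG hsm hgc).X ◁ D.hat.translation k).left).obj
        (A.poincarePullback u K hK hcov hG hsm hgc D hfree) ≅ A.poincarePullback u K hK hcov hG hsm hgc D hfree) :=
  Iff.rfl

/-- `1` stabilises `𝒩₁`. [cite: MumfordAV1970, §15 Thm. 1 (p. 143)] -/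
theorem one_mem_poincareStabilizer : (1 : D.hat.Sections) ∈ A.poincareStabilizer u K hK hcov hG hsm hgc D hfree := by
  have h : ((A.quotientBy u K hcov hG hsm hgc).X ◁ D.hat.translation 1).left = 𝟙 _ := by
    rw [whiskerLeft_translation_one]; rfl
  exact ⟨(Scheme.Modules.pullbackCongr h).app _ ≪≫ (Scheme.Modules.pullbackId (X := _)).app _⟩

/-- The stabiliser is closed under products (compose the isomorphisms along `B ◁ t_{kk′} = (B ◁ t_{k′}) ≫ (B ◁ t_k)`).
[cite: MumfordAV1970, §15 Thm. 1 (p. 143)] -/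
theorem mul_mem_poincareStabilizer {k k' : D.hat.Sections} (hk : k ∈ A.poincareStabilizer u K hK hcov hG hsm hgc D hfree)
    (hk' : k' ∈ A.poincareStabilizer u K hK hcov hG hsm hgc D hfree) :
    k * k' ∈ A.poincareStabilizer u K hK hcov hG hsm hgc D hfree := by
  obtain ⟨e⟩ := hk
  obtain ⟨e'⟩ := hk'
  have h : ((A.quotientBy u K hcov hG hsm hgc).X ◁ D.hat.translation (k * k')).left =
      ((A.quotientBy u K hcov hG hsm hgc).X ◁ D.hat.translation k').left ≫
        ((A.quotientBy u K hcov hG hsm hgc).X ◁ D.hat.translation k).left := by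
    rw [← Over.comp_left, whiskerLeft_translation_mul]
  exact ⟨(Scheme.Modules.pullbackCongr h).app _ ≪≫ ((Scheme.Modules.pullbackComp _ _).app _).symm ≪≫
    (Scheme.Modules.pullback _).mapIso e ≪≫ e'⟩

/-- The stabiliser is closed under inverses. [cite: MumfordAV1970, §15 Thm. 1 (p. 143)] -/
theorem inv_mem_poincareStabilizer {k : D.hat.Sections} (hk : k ∈ A.poincareStabilizer u K hK hcov hG hsm hgc D hfree) :
    k⁻¹ ∈ A.poincareStabilizer u K hK hcov hG hsm hgc D hfree := by
  obtain ⟨e⟩ := hk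
  have h1 : ((A.quotientBy u K hcov hG hsm hgc).X ◁ D.hat.translation k⁻¹).left ≫
      ((A.quotientBy u K hcov hG hsm hgc).X ◁ D.hat.translation k).left = 𝟙 _ := by
    rw [← Over.comp_left, ← whiskerLeft_translation_mul, mul_inv_cancel, whiskerLeft_translation_one]; rfl
  exact ⟨(Scheme.Modules.pullback _).mapIso e.symm ≪≫ (Scheme.Modules.pullbackComp _ _).app _ ≪≫
    (Scheme.Modules.pullbackCongr h1).app _ ≪≫ (Scheme.Modules.pullbackId (X := _)).app _⟩

/-- **`K′_max`: the stabiliser of `𝒩₁` as a SUBGROUP of `Â(S)`** (formal from the three lemmas above).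
[cite: MumfordAV1970, §15 Thm. 1 (p. 143)] -/
def poincareStabilizerSubgroup : Subgroup D.hat.Sections where
  carrier := A.poincareStabilizer u K hK hcov hG hsm hgc D hfree
  one_mem' := A.one_mem_poincareStabilizer u K hK hcov hG hsm hgc D hfree
  mul_mem' := fun hk hk' => A.mul_mem_poincareStabilizer u K hK hcov hG hsm hgc D hfree hk hk'
  inv_mem' := fun hk => A.inv_mem_poincareStabilizer u K hK hcov hG hsm hgc D hfree hk

/-- Membership in the stabiliser subgroup. [cite: MumfordAV1970, §15 Thm. 1 (p. 143)] -/
theorem mem_poincareStabilizerSubgroup_iff (k : D.hat.Sections) :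
    k ∈ A.poincareStabilizerSubgroup u K hK hcov hG hsm hgc D hfree ↔ k ∈ A.poincareStabilizer u K hK hcov hG hsm hgc D hfree :=
  Iff.rfl

end AbelianSchemeOver

end Literature.AlgebraicGeometry.AbelianSchemes

end
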